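import Summits.ResolutionOfSingularities.ResolutionOfSingularities.Theorems.SectionAscentFibrewiseClosedPointsCertificateRegularChart
import Summits.ResolutionOfSingularities.ResolutionOfSingularities.Theorems.SectionAscentFibrewiseClosedPointsCertificateRegularLocQuot
import Summits.ResolutionOfSingularities.ResolutionOfSingularities.Theorems.SectionAscentFibrewiseClosedPointsCertificatesOnRegularBlowupAlgebra
import Literature.AlgebraicGeometry.Resolution.AffineBlowupAlgebra
import Literature.AlgebraicGeometry.Resolution.RegularLocalRingsQuotient
import Mathlib.RingTheory.RegularLocalRing.Polynomial
import Mathlib.RingTheory.FiniteType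
import HarnessLib

/-!
# Local rings of the strict transform of the generic member on a regular blowing up: chart form

Support file for crux stmt-ResolutionOfSingularities-15960
(`SectionAscent.FibrewiseClosedPoints`, line `registered`, calibration stub
`stub_certificatesOnRegularBlowup`).

Let `C₀ = (A[It])_{(at)}` be a chart ring of `Bl_I(Spec A)` (`A` a domain of finite type over a
field `K`, `0 ≠ a ∈ I`) all of whose local rings are regular, `g₁, …, g_s ∈ A`,
`c_j ∈ C₀` with `a^m c_j = g_j` (`c_j = g_j t^m/(at)^m`) such that (H) every prime of `C₀`
containing all `c_j` is maximal and generated by them (the sections `g_j t^m` have at most one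
base point on the chart, a closed point whose maximal ideal they generate). Suppose a ring `E`
receives `D = C₀[t₁, …, t_s]` by `θ₀` with the kernel described by
`θ₀(d) = 0 ⇒ a^N d σ = ℓ₀ d''` (`ℓ₀ = a^m ℓ'`, `ℓ' = Σ c_j t_j`, `0 ≠ σ ∈ K[t]`), `θ₀(ℓ₀) = 0`,
`θ₀(a)` a non-zero-divisor, every element of `E` a fraction `θ₀(d)/θ₀(σ)`, and `θ₀(σ)` a unit
for `σ ≠ 0` — the chart ring of the blowing up along `I` of the generic member `Σ t_j g_j`
(`…CertificateRegularStrictTransform`). Then every local ring of `E` is regular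
(`isRegularLocalRing_localization_sectionChart`): it is `T/(ker θ₀)T` for a localization `T`
of `D` at a prime `𝔔` (`…CertificateRegularLocQuot`); `T` is regular (Mathlib: polynomial rings
over regular rings); `ℓ' ∉ 𝔪_T²` (`…CertificatesOnRegularBlowupAlgebra`: off the base point by
the derivation `∂/∂t_j`, at the base point by the Nullstellensatz and a leading-coefficient
argument), so `T/ℓ'T` is regular (Matsumura 14.2), a domain in which `a ≠ 0`, whence
`(ker θ₀)T = ℓ'T`. No definitions are introduced.

References: H. Matsumura, *Commutative Ring Theory*, Thm. 14.2, Thm. 14.3, Thm. 19.5;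
The Stacks Project, Tag 080E; everything below is folklore.
-/

-- single-problem summit: the doubled namespace component is forced
set_option linter.dupNamespace false
-- Mathlib is built with this depth; the default (1) makes instance search on the chart rings fail
set_option maxSynthPendingDepth 3

noncomputable section

namespace Summit.ResolutionOfSingularities.ResolutionOfSingularities.Theorems.SectionAscent.CertificatesOnRegularBlowup

open MvPolynomial IsLocalRing Literature.AlgebraicGeometry.Resolution
open Summit.ResolutionOfSingularities.ResolutionOfSingularities.Theorems.SectionAscent.CertificateRegular
open scoped BigOperators

/-! ## The chart ring as a `K`-algebra of finite type -/

/-- The chart ring `(A[It])_{(at)}` is of finite type over `K` for the structure map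
`K → A → (A[It])_{(at)}` (`A` Noetherian: the Rees algebra is of finite type over its
degree-zero part `A`, and Mathlib's `HomogeneousLocalization.Away.finiteType`). [folklore] -/
theorem finiteType_chart (K A : Type) [Field K] [CommRing A] [Algebra K A]
    [Algebra.FiniteType K A] [IsNoetherianRing A] (I : Ideal A) (a : A) (ha : a ∈ I) :
    letI := ((reesChartBase a ha).comp (algebraMap K A)).toAlgebra
    Algebra.FiniteType K (HomogeneousLocalization.Away (reesGrading I) (reesT a ha)) := by
  have h1 : (algebraMap K A).FiniteType := RingHom.finiteType_algebraMap.mpr inferInstance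
  have h2 : (reesGrading.zeroRingHom I).FiniteType :=
    RingHom.FiniteType.of_surjective _ (reesGrading.zeroRingHom_bijective I).2
  have h3 : (algebraMap (reesGrading I 0)
      (HomogeneousLocalization.Away (reesGrading I) (reesT a ha))).FiniteType :=
    RingHom.finiteType_algebraMap.mpr
      (HomogeneousLocalization.Away.finiteType (reesT a ha) 1 (reesT_mem a ha))
  exact (h3.comp h2).comp h1

/-! ## Kernels of a localization followed by a surjection: two generic lemmas -/

/-- If `θ(x) = 0`, `θ(y)` is a non-zero-divisor and `ker θ ⊆ 𝔔`, then `y ∉ x D_𝔔`: from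
`y v = x e` (`v ∉ 𝔔`) we get `θ(y) θ(v) = 0`, `θ(v) = 0`, `v ∈ 𝔔`. [folklore] -/
theorem algebraMap_not_mem_span {D E T : Type*} [CommRing D] [CommRing E] [CommRing T]
    (θ : D →+* E) (𝔔 : Ideal D) [h𝔔 : 𝔔.IsPrime] [Algebra D T] [IsLocalization.AtPrime T 𝔔]
    (hker : ∀ d, θ d = 0 → d ∈ 𝔔) {x y : D} (hx : θ x = 0) (hy : θ y ∈ nonZeroDivisors E) :
    algebraMap D T y ∉ Ideal.span {algebraMap D T x} := by
  intro hmem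
  rw [Ideal.mem_span_singleton'] at hmem
  obtain ⟨z, hz⟩ := hmem
  obtain ⟨⟨e, v⟩, rfl⟩ := IsLocalization.mk'_surjective 𝔔.primeCompl z
  have h1 : algebraMap D T (e * x) = algebraMap D T (y * (v : D)) := by
    rw [map_mul, map_mul, ← hz, mul_right_comm, IsLocalization.mk'_spec]
  rw [IsLocalization.eq_iff_exists 𝔔.primeCompl T] at h1
  obtain ⟨w, hw⟩ := h1
  have h2 : θ y * θ ((w : D) * (v : D)) = 0 := by
    have e2 := congrArg θ hw
    simp only [map_mul, hx, mul_zero] at e2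
    rw [map_mul]
    linear_combination -e2
  have h3 : (w : D) * (v : D) ∈ 𝔔 := hker _ ((mem_nonZeroDivisors_iff_left.mp hy) _ h2)
  exact (h𝔔.mem_or_mem h3).elim w.2 v.2

/-- **Saturation in a domain.** If `θ(x) = 0`, the kernel of `θ` is described by
`θ(d) = 0 ⇒ yᴺ d u = yᵐ x d''` with `u ∉ 𝔔`, and in `T = D_𝔔` the ideal `xT` is prime with
`y ∉ xT`, then `(ker θ) T = x T`. [folklore] -/
theorem map_ker_eq_span {D E T : Type*} [CommRing D] [CommRing E] [CommRing T]
    (θ : D →+* E) (𝔔 : Ideal D) [𝔔.IsPrime] [Algebra D T] [IsLocalization.AtPrime T 𝔔]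
    {x y : D} {m : ℕ} (hx : θ x = 0)
    (hkerθ : ∀ d, θ d = 0 → ∃ (N : ℕ) (u : D), u ∉ 𝔔 ∧ ∃ d'', y ^ N * d * u = y ^ m * x * d'')
    (hprime : (Ideal.span {algebraMap D T x}).IsPrime)
    (hy : algebraMap D T y ∉ Ideal.span {algebraMap D T x}) :
    (RingHom.ker θ).map (algebraMap D T) = Ideal.span {algebraMap D T x} := by
  apply le_antisymm
  · rw [Ideal.map_le_iff_le_comap]
    intro d hd
    rw [Ideal.mem_comap]
    obtain ⟨N, u, hu, d'', hrel⟩ := hkerθ d hd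
    have huu : IsUnit (algebraMap D T u) := IsLocalization.map_units T (⟨u, hu⟩ : 𝔔.primeCompl)
    have hmem : algebraMap D T (y ^ N * d * u) ∈ Ideal.span {algebraMap D T x} := by
      rw [hrel, map_mul, map_mul, map_pow]
      exact Ideal.mul_mem_right _ _ (Ideal.mul_mem_left _ _ (Ideal.mem_span_singleton_self _))
    rw [map_mul, map_mul, map_pow] at hmem
    rcases hprime.mem_or_mem hmem with h4 | h4
    · rcases hprime.mem_or_mem h4 with h5 | h5
      · exact absurd (hprime.mem_of_pow_mem N h5) hy
      · exact h5
    · exact absurd (Ideal.eq_top_of_isUnit_mem _ h4 huu) hprime.ne_top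
  · rw [Ideal.span_le, Set.singleton_subset_iff]
    exact Ideal.mem_map_of_mem _ hx

section Chart

variable (K A : Type) [Field K] [CommRing A] [IsDomain A] [IsNoetherianRing A] [Algebra K A]
  [Algebra.FiniteType K A] (I : Ideal A) (a : A) (ha : a ∈ I) (ha0 : a ≠ 0) (s m : ℕ)
  (g : Fin s → A)
  (c : Fin s → HomogeneousLocalization.Away (reesGrading I) (reesT a ha))
  (hc : ∀ j, reesChartBase a ha (a ^ m) * c j = reesChartBase a ha (g j))
  (H : ∀ q : Ideal (HomogeneousLocalization.Away (reesGrading I) (reesT a ha)), q.IsPrime →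
    (∀ j, c j ∈ q) → q.IsMaximal ∧ q = Ideal.span (Set.range c))
  (E : Type) [CommRing E]
  (θ₀ : MvPolynomial (Fin s) (HomogeneousLocalization.Away (reesGrading I) (reesT a ha)) →+* E)
  (hkerθ : ∀ d, θ₀ d = 0 → ∃ (N : ℕ) (σ : MvPolynomial (Fin s) K), σ ≠ 0 ∧ ∃ d'',
    MvPolynomial.C (reesChartBase a ha a) ^ N * d *
      MvPolynomial.map ((reesChartBase a ha).comp (algebraMap K A)) σ =
        (∑ j : Fin s, MvPolynomial.C (reesChartBase a ha (g j)) * MvPolynomial.X j) * d'')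
  (hθℓ : θ₀ (∑ j : Fin s, MvPolynomial.C (reesChartBase a ha (g j)) * MvPolynomial.X j) = 0)
  (hθa : θ₀ (MvPolynomial.C (reesChartBase a ha a)) ∈ nonZeroDivisors E)

include ha0 hc H hkerθ hθℓ hθa in
/-- **The quotient `T/(ker θ₀)T` is a regular local ring** for every localization `T` of
`D = C₀[t]` at a prime `𝔔 ⊇ ker θ₀` avoiding the non-zero scalars, `T` regular (see the module
docstring: `ℓ' ∉ 𝔪_T²`, `T/ℓ'T` is a regular domain with `a ≠ 0`, `(ker θ₀)T = ℓ'T`).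
[cite: Matsumura1987, Thm. 14.2] -/
theorem isRegularLocalRing_quotient_map_ker
    (𝔔 : Ideal (MvPolynomial (Fin s) (HomogeneousLocalization.Away (reesGrading I) (reesT a ha))))
    [h𝔔 : 𝔔.IsPrime] (h𝔔ker : ∀ d, θ₀ d = 0 → d ∈ 𝔔)
    (hS : ∀ σ : MvPolynomial (Fin s) K, σ ≠ 0 →
      MvPolynomial.map ((reesChartBase a ha).comp (algebraMap K A)) σ ∉ 𝔔)
    (T : Type) [CommRing T] [IsLocalRing T]
    [Algebra (MvPolynomial (Fin s) (HomogeneousLocalization.Away (reesGrading I) (reesT a ha))) T]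
    [IsLocalization.AtPrime T 𝔔] (hT : IsRegularLocalRing T) :
    IsRegularLocalRing (T ⧸ (RingHom.ker θ₀).map (algebraMap
      (MvPolynomial (Fin s) (HomogeneousLocalization.Away (reesGrading I) (reesT a ha))) T)) := by
  haveI hC₀noeth : IsNoetherianRing (HomogeneousLocalization.Away (reesGrading I) (reesT a ha)) :=
    isNoetherianRing_away' a ha
  haveI hC₀dom : IsDomain (HomogeneousLocalization.Away (reesGrading I) (reesT a ha)) :=
    isDomain_away' a ha ha0
  have ha₀ : reesChartBase a ha a ≠ 0 := fun h =>
    ha0 (reesChartBase_injective' a ha ha0 (h.trans (map_zero _).symm))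
  letI algKC : Algebra K (HomogeneousLocalization.Away (reesGrading I) (reesT a ha)) :=
    ((reesChartBase a ha).comp (algebraMap K A)).toAlgebra
  haveI : Algebra.FiniteType K (HomogeneousLocalization.Away (reesGrading I) (reesT a ha)) :=
    finiteType_chart K A I a ha
  haveI := hT
  -- the elements `ℓ' = Σ c_j t_j`, `ℓ₀ = a^m ℓ'` of `D = C₀[t]`
  obtain ⟨ℓ', hℓ'⟩ :
      ∃ ℓ' : MvPolynomial (Fin s) (HomogeneousLocalization.Away (reesGrading I) (reesT a ha)),
        ℓ' = ∑ j : Fin s, C (c j) * X j := ⟨_, rfl⟩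
  have hℓ₀ : (∑ j : Fin s, C (reesChartBase a ha (g j)) * X j) =
      C (reesChartBase a ha a) ^ m * ℓ' := by
    rw [hℓ', Finset.mul_sum]
    refine Finset.sum_congr rfl fun j _ => ?_
    have hpow : (C (reesChartBase a ha (a ^ m)) : MvPolynomial (Fin s) _) =
        C (reesChartBase a ha a) ^ m := by
      rw [map_pow, map_pow]
    rw [← mul_assoc, ← hpow, ← map_mul, hc j]
  have hθℓ' : θ₀ ℓ' = 0 := by
    rw [hℓ₀, map_mul, map_pow] at hθℓ
    exact (mem_nonZeroDivisors_iff_left.mp (pow_mem hθa m)) _ hθℓ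
  have hℓ'𝔔 : ℓ' ∈ 𝔔 := h𝔔ker _ hθℓ'
  have hinjK : Function.Injective ((reesChartBase a ha).comp (algebraMap K A)) :=
    (reesChartBase_injective' a ha ha0).comp (algebraMap K A).injective
  by_cases h0 : ∀ j, c j = 0
  · -- no base point on the chart and `ℓ' = 0`: the kernel is trivial
    have hℓ'0 : ℓ' = 0 := by
      rw [hℓ']
      exact Finset.sum_eq_zero fun j _ => by rw [h0 j, map_zero, zero_mul]
    have hker : RingHom.ker θ₀ = ⊥ := by
      refine le_bot_iff.mp fun d hd => ?_
      obtain ⟨N, σ, hσ, d'', hrel⟩ := hkerθ d hd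
      rw [hℓ₀, hℓ'0, mul_zero, zero_mul] at hrel
      have h1 : (C (reesChartBase a ha a) : MvPolynomial (Fin s) _) ^ N ≠ 0 :=
        pow_ne_zero _ (by rwa [Ne, MvPolynomial.C_eq_zero])
      have h2 : MvPolynomial.map ((reesChartBase a ha).comp (algebraMap K A)) σ ≠ 0 := fun h =>
        hσ (MvPolynomial.map_injective _ hinjK (h.trans (map_zero _).symm))
      rcases mul_eq_zero.mp hrel with h3 | h3
      · exact (mul_eq_zero.mp h3).resolve_left h1
      · exact absurd h3 h2
    rw [hker, Ideal.map_bot]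
    exact IsRegularLocalRing.of_ringEquiv (RingEquiv.quotientBot T).symm
  · push Not at h0
    -- `ℓ' ∈ 𝔪_T ∖ 𝔪_T²`
    have hkey : algebraMap _ T ℓ' ∉ (maximalIdeal T) ^ 2 := by
      rw [hℓ']
      by_cases h1 : ∃ j, C (c j) ∉ 𝔔
      · obtain ⟨j, hj⟩ := h1
        exact algebraMap_linearForm_not_mem_sq c 𝔔 T hj
      · push Not at h1
        haveI : (𝔔.comap C).IsPrime := Ideal.comap_isPrime _ _
        obtain ⟨hmax, hspan⟩ := H (𝔔.comap C) inferInstance fun j => h1 j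
        haveI := hmax
        exact algebraMap_linearForm_not_mem_sq_of_isMaximal K _ c (𝔔.comap C) hspan h0 𝔔 h1 hS T
    have hℓ'max : algebraMap _ T ℓ' ∈ maximalIdeal T :=
      (IsLocalization.AtPrime.to_map_mem_maximal_iff T 𝔔 _).mpr hℓ'𝔔
    -- `T/ℓ'T` is a regular local ring, hence a domain: `ℓ'T` is prime
    obtain ⟨hregQ, -⟩ := IsRegularLocalRing.quotient_span_singleton hℓ'max hkey
    haveI := hregQ
    haveI : IsDomain (T ⧸ Ideal.span {algebraMap _ T ℓ'}) := isDomain_of_isRegularLocalRing _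
    have hprime : (Ideal.span {algebraMap _ T ℓ'}).IsPrime :=
      (Ideal.Quotient.isDomain_iff_prime _).mp inferInstance
    -- `a ∉ ℓ'T`, whence `(ker θ₀) T = ℓ' T`
    have haℓ := algebraMap_not_mem_span θ₀ 𝔔 (T := T) h𝔔ker hθℓ' hθa
    have hmapker : (RingHom.ker θ₀).map (algebraMap _ T) = Ideal.span {algebraMap _ T ℓ'} := by
      refine map_ker_eq_span θ₀ 𝔔 (m := m) hθℓ' (fun d hd => ?_) hprime haℓ
      obtain ⟨N, σ, hσ, d'', hrel⟩ := hkerθ d hd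
      exact ⟨N, _, hS σ hσ, d'', by rw [hrel, hℓ₀]⟩
    exact IsRegularLocalRing.of_ringEquiv (Ideal.quotEquivOfEq hmapker.symm)

include ha0 hc H hkerθ hθℓ hθa in
/-- **Every local ring of the chart ring `E` of the blowing up of the generic member is
regular** when all local rings of `C₀` are regular (see the module docstring):
`E_𝔮 ≅ T/(ker θ₀)T` for `T = D_𝔔`, `𝔔 = θ₀⁻¹(𝔮)` (`…CertificateRegularLocQuot`), `T` is regular
(polynomial rings over regular rings, Mathlib), and `isRegularLocalRing_quotient_map_ker`.
[cite: Matsumura1987, Thm. 19.5] -/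
theorem isRegularLocalRing_localization_sectionChart
    (hregC : ∀ p : PrimeSpectrum (HomogeneousLocalization.Away (reesGrading I) (reesT a ha)),
      IsRegularLocalRing (Localization.AtPrime p.asIdeal))
    (hgen : ∀ e : E, ∃ σ : MvPolynomial (Fin s) K, σ ≠ 0 ∧ ∃ d,
      e * θ₀ (MvPolynomial.map ((reesChartBase a ha).comp (algebraMap K A)) σ) = θ₀ d)
    (hunit : ∀ σ : MvPolynomial (Fin s) K, σ ≠ 0 →
      IsUnit (θ₀ (MvPolynomial.map ((reesChartBase a ha).comp (algebraMap K A)) σ)))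
    (𝔮 : PrimeSpectrum E) : IsRegularLocalRing (Localization.AtPrime 𝔮.asIdeal) := by
  haveI : IsNoetherianRing (HomogeneousLocalization.Away (reesGrading I) (reesT a ha)) :=
    isNoetherianRing_away' a ha
  haveI : IsRegularRing (HomogeneousLocalization.Away (reesGrading I) (reesT a ha)) :=
    isRegularRing_iff.mpr fun p hp => hregC ⟨p, hp⟩
  haveI h𝔔 : (𝔮.asIdeal.comap θ₀).IsPrime := Ideal.comap_isPrime θ₀ 𝔮.asIdeal
  have h𝔔ker : ∀ d, θ₀ d = 0 → d ∈ 𝔮.asIdeal.comap θ₀ := fun d hd => by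
    rw [Ideal.mem_comap, hd]
    exact Ideal.zero_mem _
  have hS' : ∀ x ∈ (nonZeroDivisors (MvPolynomial (Fin s) K)).map
      (MvPolynomial.map ((reesChartBase a ha).comp (algebraMap K A))),
      x ∉ 𝔮.asIdeal.comap θ₀ := by
    rintro _ ⟨σ, hσ, rfl⟩ h
    exact 𝔮.isPrime.ne_top
      (Ideal.eq_top_of_isUnit_mem _ (Ideal.mem_comap.mp h) (hunit σ (nonZeroDivisors.ne_zero hσ)))
  have hS : ∀ σ : MvPolynomial (Fin s) K, σ ≠ 0 →
      MvPolynomial.map ((reesChartBase a ha).comp (algebraMap K A)) σ ∉ 𝔮.asIdeal.comap θ₀ :=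
    fun σ hσ => hS' _ ⟨σ, mem_nonZeroDivisors_of_ne_zero hσ, rfl⟩
  have hgen' : ∀ e : E, ∃ x ∈ (nonZeroDivisors (MvPolynomial (Fin s) K)).map
      (MvPolynomial.map ((reesChartBase a ha).comp (algebraMap K A))), ∃ d, e * θ₀ x = θ₀ d := by
    intro e
    obtain ⟨σ, hσ, d, h⟩ := hgen e
    exact ⟨_, ⟨σ, mem_nonZeroDivisors_of_ne_zero hσ, rfl⟩, d, h⟩
  obtain ⟨𝔮', h𝔮', ⟨e𝔮'⟩⟩ := exists_primeSpectrum_ringEquiv_quotient θ₀ _ (𝔮.asIdeal.comap θ₀)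
    hgen' hS' h𝔔ker (Localization.AtPrime (𝔮.asIdeal.comap θ₀))
  have heq : 𝔮' = 𝔮 := primeSpectrum_eq_of_comap_eq θ₀ _ hgen' hS' h𝔮'
  subst heq
  have hT : IsRegularLocalRing (Localization.AtPrime (𝔮'.asIdeal.comap θ₀)) := inferInstance
  haveI := isRegularLocalRing_quotient_map_ker K A I a ha ha0 s m g c hc H E θ₀ hkerθ hθℓ hθa
    (𝔮'.asIdeal.comap θ₀) h𝔔ker hS (Localization.AtPrime (𝔮'.asIdeal.comap θ₀)) hT
  exact IsRegularLocalRing.of_ringEquiv e𝔮'.symm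

end Chart

/-- **Registered form** (`stub_certificatesOnRegularBlowupChart`): every local ring of the chart
ring `E` of the blowing up of the generic member is regular when the chart ring `C₀` of the regular
blowing up has regular local rings and the chart data satisfy (H) — see
`isRegularLocalRing_localization_sectionChart`. [cite: Matsumura1987, Thm. 14.2] -/
theorem stub_certificatesOnRegularBlowupChart (K A : Type) [Field K] [CommRing A] [IsDomain A] [IsNoetherianRing A] [Algebra K A] [Algebra.FiniteType K A] (I : Ideal A) (a : A) (ha : a ∈ I) (ha0 : a ≠ 0) (s m : ℕ) (g : Fin s → A) (c : Fin s → HomogeneousLocalization.Away (Literature.AlgebraicGeometry.Resolution.reesGrading I) (Literature.AlgebraicGeometry.Resolution.reesT a ha)) (hc : ∀ j, Literature.AlgebraicGeometry.Resolution.reesChartBase a ha (a ^ m) * c j = Literature.AlgebraicGeometry.Resolution.reesChartBase a ha (g j)) (H : ∀ q : Ideal (HomogeneousLocalization.Away (Literature.AlgebraicGeometry.Resolution.reesGrading I) (Literature.AlgebraicGeometry.Resolution.reesT a ha)), q.IsPrime → (∀ j, c j ∈ q) → q.IsMaximal ∧ q = Ideal.span (Set.range c)) (E : Type) [CommRing E]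 (θ₀ : MvPolynomial (Fin s) (HomogeneousLocalization.Away (Literature.AlgebraicGeometry.Resolution.reesGrading I) (Literature.AlgebraicGeometry.Resolution.reesT a ha)) →+* E) (hkerθ : ∀ d, θ₀ d = 0 → ∃ (N : ℕ) (σ : MvPolynomial (Fin s) K), σ ≠ 0 ∧ ∃ d'', MvPolynomial.C (Literature.AlgebraicGeometry.Resolution.reesChartBase a ha a) ^ N * d * MvPolynomial.map ((Literature.AlgebraicGeometry.Resolution.reesChartBase a ha).comp (algebraMap K A)) σ = (∑ j : Fin s, MvPolynomial.C (Literature.AlgebraicGeometry.Resolution.reesChartBase a ha (g j)) * MvPolynomial.X j) * d'') (hθℓ : θ₀ (∑ j : Fin s, MvPolynomial.C (Literature.AlgebraicGeometry.Resolution.reesChartBase a ha (g j)) * MvPolynomial.X j) = 0) (hθa : θ₀ (MvPolynomial.C (Literature.AlgebraicGeometry.Resolution.reesChartBase a ha a)) ∈ nonZeroDivisors E) (hregC : ∀ p : PrimeSpectrum (HomogeneousLocalization.Away (Literature.AlgebraicGeometry.Resolution.reesGrading I) (Literature.AlgebraicGeometry.Resolution.reesT a ha)), IsRegularLocalRing (Localization.AtPrime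 p.asIdeal)) (hgen : ∀ e : E, ∃ σ : MvPolynomial (Fin s) K, σ ≠ 0 ∧ ∃ d, e * θ₀ (MvPolynomial.map ((Literature.AlgebraicGeometry.Resolution.reesChartBase a ha).comp (algebraMap K A)) σ) = θ₀ d) (hunit : ∀ σ : MvPolynomial (Fin s) K, σ ≠ 0 → IsUnit (θ₀ (MvPolynomial.map ((Literature.AlgebraicGeometry.Resolution.reesChartBase a ha).comp (algebraMap K A)) σ))) (𝔮 : PrimeSpectrum E) : IsRegularLocalRing (Localization.AtPrime 𝔮.asIdeal) :=
  isRegularLocalRing_localization_sectionChart K A I a ha ha0 s m g c hc H E θ₀ hkerθ hθℓ hθa hregC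
    hgen hunit 𝔮

end Summit.ResolutionOfSingularities.ResolutionOfSingularities.Theorems.SectionAscent.CertificatesOnRegularBlowup

end
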